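import Literature.AlgebraicGeometry.Motives.FaltingsECSemisimpleAssemblyProofs
import HarnessLib

/-!
# Faltings 1983, Satz 3 for an elliptic curve: the discharge

Theorem-only `Proofs` companion of `Literature.AlgebraicGeometry.Motives.FaltingsEC`, closing its
named fact `Literature.AlgebraicGeometry.Motives.isSemisimpleRepresentation_rationalGaloisRepTate W ℓ`
— G. Faltings, *Endlichkeitssätze für abelsche Varietäten über Zahlkörpern*, Invent. Math. 73
(1983), 349–366, §5 Satz 3 for `A = E` an elliptic curve over a number field `K`: the rational
Tate module `V_ℓ E = T_ℓ E ⊗ ℚ_ℓ` is a semisimple `ℚ_ℓ[Γ_K]`-module (English translation: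
G. Cornell, J. H. Silverman (eds.), *Arithmetic Geometry*, Springer 1986, Ch. II §5, Theorem 3,
held copy `book:cornellnd-arithmetic-geometry`, PDF p. 89: "the operation of `π` on
`T_ℓ(A) ⊗ ℚ_ℓ` is semisimple").

The printed proof (§5, proof of Sätze 3–4) runs Tate's lattice argument on the quotients `A/G_n`
attached to a `π`-stable subspace `W ⊆ V_ℓ A`, the finiteness of the isomorphism classes among
the `A/G_n` being supplied by Satz 1 (finiteness for bounded height) and Satz 2
(`h(A/G_n) = h(A)`). For `g = 1` the tree carries out exactly this deduction with the finiteness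
input in the form of Silverman, *AEC*, Cor. IX.6.2 (an isogeny class of elliptic curves over `K`
meets only finitely many `K`-isomorphism classes):
`isSemisimpleRepresentation_rationalGaloisRepTate_of_isogenyClass`
(`FaltingsECSemisimpleAssemblyProofs`; CM case unconditional, non-CM case by Tate's argument on
the quotients `E/G_n` of a stable line, *AEC* III.4.12 and III.7.4 being theorems of the tree).
Cor. IX.6.2 is now itself a theorem of the tree, `WeierstrassCurve.finite_isogenyClass_holds`
(`IsogenyClassFiniteProofs`: Shafarevich's Thm. IX.6.1 from Siegel's Cor. IX.3.2.1,
`WeierstrassCurve.siegel_finite_integralPoints_holds`, via the unit equation; and Cor. VII.7.2,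
`WeierstrassCurve.IsIsogenous.badPlaces_eq_holds`). Composing the two gives the discharge.

## Contents (proved; no definitions, no new named facts)

* `isSemisimpleRepresentation_rationalGaloisRepTate_holds W ℓ` — **Satz 3 for elliptic curves,
  unconditionally**, for every Weierstrass curve `W` over every field `K` and every prime `ℓ`
  (the hypotheses `[NumberField K] [W.IsElliptic]` live inside the fact).

## References

* [Faltings1983Endlichkeit] G. Faltings, Invent. Math. 73 (1983), 349–366, §5 Satz 3 and the
  proof of Sätze 3–4; Engl. transl. Cornell–Silverman, *Arithmetic Geometry* (1986), Ch. II §5,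
  Theorem 3 (held copy `book:cornellnd-arithmetic-geometry`, PDF pp. 89–90, read).
* [SilvermanAEC2009] J. H. Silverman, *The Arithmetic of Elliptic Curves*, 2nd ed., GTM 106,
  Prop. III.4.12, Thm. III.7.4, Cor. VII.7.2, Cor. IX.3.2.1, Thm. IX.6.1, Cor. IX.6.2.

## Design

One theorem, a one-line composition of the tree's reductions; `noncomputable section`, one
universe `u`, `namespace Literature.AlgebraicGeometry.Motives`, conventions of `FaltingsEC`.
-/

noncomputable section

universe u

namespace Literature.AlgebraicGeometry.Motives

open WeierstrassCurve

variable {K : Type u} [Field K] (W : WeierstrassCurve K) (ℓ : ℕ) [Fact ℓ.Prime]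

/-- **Faltings' Satz 3 for an elliptic curve (discharge of the named fact).** For a Weierstrass
curve `W` over a field `K` and a prime `ℓ`, the named fact
`isSemisimpleRepresentation_rationalGaloisRepTate W ℓ` holds: if `K` is a number field and `W`
is elliptic, the rational Tate module `V_ℓ E` is a semisimple `ℚ_ℓ`-linear representation of
`Γ_K = Gal(K̄/K)`. Proof: the tree's `isSemisimpleRepresentation_rationalGaloisRepTate_of_isogenyClass`
(Tate's argument on the quotients of `E` by the finite levels of a stable line, granted the
finiteness of the `K`-isomorphism classes in the `K`-isogeny class of `E` when `E` has no
`K`-rational CM) fed with `WeierstrassCurve.finite_isogenyClass_holds` (Silverman, *AEC*,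
Cor. IX.6.2, a theorem of the tree via Shafarevich IX.6.1 and Siegel IX.3.2.1).
[cite: Faltings1983Endlichkeit, §5 Satz 3] -/
theorem isSemisimpleRepresentation_rationalGaloisRepTate_holds :
    isSemisimpleRepresentation_rationalGaloisRepTate W ℓ :=
  isSemisimpleRepresentation_rationalGaloisRepTate_of_isogenyClass W ℓ fun _ ↦
    finite_isogenyClass_holds W

end Literature.AlgebraicGeometry.Motives

end
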